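import Summits.ResolutionOfSingularities.ResolutionOfSingularities.Theorems.WildQuotientsSummitReductionStubPairCanonicalStrictificationLemmas
import Summits.ResolutionOfSingularities.ResolutionOfSingularities.Theorems.WildQuotientsSummitReductionStubPairCanonicalStrictificationPieces
import Literature.AlgebraicGeometry.Resolution.AlterationsSemiStable
import Literature.AlgebraicGeometry.Resolution.AlterationsSemiStableResolution
import Literature.AlgebraicGeometry.Resolution.AlterationsBlowupDivisorProofs
import Literature.AlgebraicGeometry.Resolution.AlterationsStrong
import Literature.AlgebraicGeometry.Resolution.NormalCrossingsStrictification
import Literature.AlgebraicGeometry.Resolution.BlowupsEquivariant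
import Literature.AlgebraicGeometry.Resolution.BlowupsComposition
import Literature.AlgebraicGeometry.Motives.CartierDivisor
import Mathlib.AlgebraicGeometry.Geometrically.Irreducible
import HarnessLib

/-!
# `WildQuotients.SummitReduction` (stmt-ResolutionOfSingularities-16324), line `FramePerfect`, skeleton v6:
# stub `stub_pair_canonicalStrictification` (de Jong 1996, 7.2: canonical strictification, equivariant) — PROVED

Route `ResolutionOfSingularities/WildQuotients`, crux `SummitReduction`; registered stub of the line skeleton
`Cruxes/SummitReduction/Lines/FramePerfect.lean` (v6, lead c4). Worker file.

De Jong 1996, 7.2 (pp. 87–88): for an excellent `S` with a normal crossings divisor `D`, the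
composite `S^(d) → … → S` of the blowings up of the closures of the strata
`D^(i) = {s | #n⁻¹(s) = i}` (`n` the normalisation of `D`), deepest first, has (i) reduced inverse
image of `D` a STRICT normal crossings divisor; "Since `S^(d) → S` is defined intrinsically in terms
of the pair `(S, D)`, the action of `G` lifts … Moreover the divisor is a `G`-strict normal
crossings divisor [7.1: `Dᵢ ∩ g(Dᵢ) ≠ ∅ ⇒ Dᵢ = g(Dᵢ)`]. This is clear as all the components in
one `G`-orbit … correspond to components of `D^(i)` for a fixed `i`. By the above these do not
intersect."

Rendering. The tree proves 2.4 (`DeJong1996NormalCrossingsBlowup_holds`) by exactly this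
top-down recipe, phrased with a marked strict part `F ⊆ Z` and the canonical centre
`C = topStratum S Z F m` (the closure of the stratum of points on `m + 1` unmarked branches), but
existentially. Helper file `…StubPairCanonicalStrictificationLemmas.lean` re-runs one round for
ANY blowing up of the canonical centre (`ncBlowupTopStratum`), so that the lifted action of
`BlowupsEquivariant.lean` applies (the centre is intrinsic, hence `G`-stable:
`preimage_topStratum_aut`); helper file `…Pieces.lean` carries de Jong's component bookkeeping as
the invariant "the marked part is a union of `G`-stable closed REGULAR PIECES" (each locally cut
out by one regular parameter, hence locally irreducible; the exceptional divisor of a round and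
the preimages of old pieces are again such, `regularPiece_exceptional`, `regularPiece_preimage`)
and proves `G`-strictness of such a union (`image_eq_of_regularPieces`: an irreducible component
`K` with generic point `η` on a piece `P` and `t ∈ K ∩ gK` has `𝔭_η = I(P)_t ⊆ 𝔭_{gη}` in
`𝒪_{S,t}`, so `η ⤳ gη`, and both being maximal points, `η = gη`). This file runs the induction
equivariantly (`equivariantStrictification_aux`, `equivariantStrictification`) and assembles the
stub: the composite blowing up `b` is a modification (its centre lies in `E ∌ η_S`,
`genericPoint_not_mem_of_isNormalCrossingsDivisor`), `S'` is projective
(`IsBlowup.isProjectiveOver`), regular (`isRegular_of_isBlowup_of_support_subset`), `b⁻¹E` is a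
strict normal crossings divisor and `G`-strict.

## Sources

* A. J. de Jong, *Smoothness, semi-stability and alterations*, Publ. Math. IHÉS 83 (1996),
  2.4 (p. 55), 7.1–7.2 (pp. 87–88). [DeJong1996]
-/

-- single-problem summit: the doubled namespace component `ResolutionOfSingularities` is forced
set_option linter.dupNamespace false

noncomputable section

open CategoryTheory CategoryTheory.Limits AlgebraicGeometry TopologicalSpace
open Literature.AlgebraicGeometry.Resolution
open Literature.AlgebraicGeometry.Motives (RatFn.functionFieldMap RatFn.functionFieldMap_comp)
open Literature.AlgebraicGeometry
open Scheme.IdealSheafData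

universe u w

namespace Summit.ResolutionOfSingularities.ResolutionOfSingularities.Theorems

variable {S : Scheme.{u}} {Z F : Set S} {m : ℕ}

/-! ## Stability of the canonical centre -/

/-- **The canonical centre is stable under automorphisms preserving `Z` and `F`**: an
automorphism is étale, and the top stratum is compatible with étale morphisms
(`preimage_topStratum_of_etale`). [folklore] -/
theorem preimage_topStratum_aut [IsLocallyNoetherian S] (σ : S ≅ S) (hZ : IsClosed Z)
    (hF : IsClosed F) (hσZ : σ.hom.base ⁻¹' Z = Z) (hσF : σ.hom.base ⁻¹' F = F) :
    σ.hom.base ⁻¹' topStratum S Z F m = topStratum S Z F m := by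
  have h := preimage_topStratum_of_etale (m := m) σ.hom hZ hF
  rw [hσZ, hσF] at h
  exact h

/-- Preimages of stable subsets under an equivariant morphism are stable. [folklore] -/
theorem preimage_preimage_eq_of_equivariant {S₁ : Scheme.{u}} {φ : S₁ ⟶ S} (σ₁ : S₁ ≅ S₁)
    (σ : S ≅ S) (hφ : σ₁.hom ≫ φ = φ ≫ σ.hom) {A : Set S} (hA : σ.hom.base ⁻¹' A = A) :
    σ₁.hom.base ⁻¹' (φ ⁻¹' A) = φ ⁻¹' A := by
  ext x
  simp only [Set.mem_preimage]
  rw [← Scheme.Hom.comp_apply, hφ, Scheme.Hom.comp_apply]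
  exact Set.ext_iff.mp hA (φ x)

/-! ## The equivariant induction -/

variable {G : Type w} [Group G]

/-- **The induction of de Jong 1996, 2.4, run equivariantly and with regular pieces** (de Jong
1996, 7.2). Data: a Noetherian `S` with an action `ρ` of a group `G`, a `G`-stable normal
crossings divisor `Z`, a strict normal crossings divisor `F ⊆ Z` which is a union of a set `Ps`
of `G`-stable closed REGULAR PIECES (the ideal of `P` at each of its points is generated by one
element of a regular system of parameters), and `m` with `branchOrder Z ≤ branchOrder F + m` on
`Z`. Conclusion: a blowing up `φ : S' → S` in an ideal supported in `Z` carrying a `G`-action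
`ρ'` for which `φ` is equivariant, such that `φ⁻¹Z` is a strict normal crossings divisor and the
union of a set of `ρ'`-stable closed regular pieces. Induction on `m`: for `m = 0`, `Z = F`
(`eq_of_subset_of_branchOrder_le`); for `m + 1`, blow up the canonical centre
`C = topStratum S Z F m` — it is `G`-stable (`preimage_topStratum_aut`), so the action lifts
(`IsBlowup.liftAction`, `vanishingIdeal_comap_eq_of_action`), the new marked part `φ⁻¹(F ∪ C)` is
the union of the regular pieces `φ⁻¹C` and `φ⁻¹P`, `P ∈ Ps` (`regularPiece_exceptional`,
`regularPiece_preimage`) — apply the induction hypothesis and compose the blowing ups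
(`IsBlowup.exists_isBlowup_comp_supported`). [cite: DeJong1996, 7.2, pp. 87–88] -/
theorem equivariantStrictification_aux (m : ℕ) :
    ∀ (S : Scheme.{u}) [IsNoetherian S] (ρ : G →* Aut S) (Z F : Set S) (Ps : Set (Set S)),
      IsNormalCrossingsDivisor S Z → IsStrictNormalCrossingsDivisor S F → F ⊆ Z →
        (∀ s ∈ Z, branchOrder S Z s ≤ branchOrder S F s + m) →
        (∀ g : G, (ρ g).hom.base ⁻¹' Z = Z) → F = ⋃₀ Ps →
        (∀ P ∈ Ps, (∀ g : G, (ρ g).hom.base ⁻¹' P = P) ∧ IsClosed P ∧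
          ∀ s ∈ P, ∃ y : Fin 1 → S.presheaf.stalk s, IsRsopPart y ∧
            stalkIdeal (vanishingIdeal ⟨closure P, isClosed_closure⟩) s =
              Ideal.span {∏ i, y i}) →
        ∃ (S' : Scheme.{u}) (φ : S' ⟶ S) (I : S.IdealSheafData) (ρ' : G →* Aut S')
          (Ps' : Set (Set S')),
          IsBlowup φ I ∧ (I.support : Set S) ⊆ Z ∧ (∀ g : G, (ρ' g).hom ≫ φ = φ ≫ (ρ g).hom) ∧
          IsStrictNormalCrossingsDivisor S' (φ ⁻¹' Z) ∧ φ ⁻¹' Z = ⋃₀ Ps' ∧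
          (∀ P ∈ Ps', (∀ g : G, (ρ' g).hom.base ⁻¹' P = P) ∧ IsClosed P ∧
            ∀ s ∈ P, ∃ y : Fin 1 → S'.presheaf.stalk s, IsRsopPart y ∧
              stalkIdeal (vanishingIdeal ⟨closure P, isClosed_closure⟩) s =
                Ideal.span {∏ i, y i}) := by
  induction m with
  | zero =>
    intro S _ ρ Z F Ps hZ hF hFZ hb hZst hFPs hPs
    have hZF : Z = F :=
      eq_of_subset_of_branchOrder_le hF.isClosed hFZ fun s hs => by simpa using hb s hs
    have hid : ((𝟙 S : S ⟶ S) ⁻¹' Z : Set S) = Z := by ext; simp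
    refine ⟨S, 𝟙 S, ⊤, ρ, Ps, isBlowup_id_top S, ?_, fun g => by simp, ?_, ?_, hPs⟩
    · rw [Scheme.IdealSheafData.support_top]
      exact Set.empty_subset _
    · rw [hid, hZF]
      exact hF
    · rw [hid, hZF, hFPs]
  | succ m ih =>
    intro S _ ρ Z F Ps hZ hF hFZ hb hZst hFPs hPs
    have hZc : IsClosed Z := hZ.isClosed
    have hFc : IsClosed F := hF.isClosed
    -- `F` is stable
    have hFst : ∀ g : G, (ρ g).hom.base ⁻¹' F = F := by
      intro g
      ext x
      rw [hFPs, Set.mem_preimage, Set.mem_sUnion, Set.mem_sUnion]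
      constructor
      · rintro ⟨P, hP, hx⟩
        exact ⟨P, hP, by rwa [← Set.mem_preimage, (hPs P hP).1 g] at hx⟩
      · rintro ⟨P, hP, hx⟩
        exact ⟨P, hP, by rw [← Set.mem_preimage, (hPs P hP).1 g]; exact hx⟩
    -- the canonical centre, stable under `G`
    set C : Set S := topStratum S Z F m with hCdef
    have hC : IsClosed C := isClosed_topStratum_of_isNormalCrossingsDivisor hZ hF hFZ hb
    have hCZ : C ⊆ Z := topStratum_subset m
    have hCst : ∀ g : G, (ρ g).hom.base ⁻¹' ((⟨C, hC⟩ : Closeds S) : Set S) = (⟨C, hC⟩ : Closeds S) :=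
      fun g => preimage_topStratum_aut (ρ g) hZc hFc (hZst g) (hFst g)
    set I : S.IdealSheafData := vanishingIdeal ⟨C, hC⟩ with hIdef
    have hIZ : (I.support : Set S) ⊆ Z := by
      rw [hIdef, coe_support_vanishingIdeal]
      exact hCZ
    -- blow it up and lift the action
    obtain ⟨S₁, φ, hφ⟩ := exists_isBlowup S I
    haveI : IsNoetherian S₁ := isNoetherian_of_isBlowup hφ
    have hρI : ∀ g : G, I.comap (ρ g).hom = I := vanishingIdeal_comap_eq_of_action ρ ⟨C, hC⟩ hCst
    let ρ₁ : G →* Aut S₁ := hφ.liftAction ρ hρI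
    have hρ₁ : ∀ g : G, (ρ₁ g).hom ≫ φ = φ ≫ (ρ g).hom := hφ.liftAction_hom_comp ρ hρI
    have hpre : ∀ (g : G) {A : Set S}, (ρ g).hom.base ⁻¹' A = A →
        (ρ₁ g).hom.base ⁻¹' (φ ⁻¹' A) = φ ⁻¹' A :=
      fun g A hA => preimage_preimage_eq_of_equivariant (ρ₁ g) (ρ g) (hρ₁ g) hA
    -- one round of the recipe
    obtain ⟨hZ₁, hb₁, hpt⟩ := ncBlowupTopStratum hZ hF hFZ hb hC hφ
    have hF₁ : IsStrictNormalCrossingsDivisor S₁ (φ ⁻¹' (F ∪ C)) :=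
      isStrictNormalCrossingsDivisor_preimage_union hC hφ hZ hF hFZ hCZ hpt
    have hE₁ := regularPiece_exceptional hC hφ hZ hF hCZ hpt
    -- the new pieces
    set Ps₁ : Set (Set S₁) := insert (φ ⁻¹' C) ((fun P => φ ⁻¹' P) '' Ps) with hPs₁def
    have hF₁Ps : φ ⁻¹' (F ∪ C) = ⋃₀ Ps₁ := by
      rw [hPs₁def, Set.sUnion_insert, Set.sUnion_image, Set.preimage_union, hFPs,
        Set.preimage_sUnion, Set.union_comm]
    have hPs₁ : ∀ P ∈ Ps₁, (∀ g : G, (ρ₁ g).hom.base ⁻¹' P = P) ∧ IsClosed P ∧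
        ∀ s ∈ P, ∃ y : Fin 1 → S₁.presheaf.stalk s, IsRsopPart y ∧
          stalkIdeal (vanishingIdeal ⟨closure P, isClosed_closure⟩) s =
            Ideal.span {∏ i, y i} := by
      intro P hP
      rw [hPs₁def, Set.mem_insert_iff, Set.mem_image] at hP
      rcases hP with rfl | ⟨P₀, hP₀, rfl⟩
      · exact ⟨fun g => hpre g (hCst g), hE₁.1, hE₁.2⟩
      · obtain ⟨hst, hcl, hreg⟩ := hPs P₀ hP₀
        have hP₀F : P₀ ⊆ F := hFPs ▸ Set.subset_sUnion_of_mem hP₀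
        have h := regularPiece_preimage hC hφ hF hpt hP₀F hcl hreg
        exact ⟨fun g => hpre g (hst g), h.1, h.2⟩
    -- the induction hypothesis on `S₁`
    obtain ⟨S₂, ψ, J, ρ₂, Ps₂, hψ, hJ, hρ₂, hsnc, hZ₂Ps, hPs₂⟩ :=
      ih S₁ ρ₁ (φ ⁻¹' Z) (φ ⁻¹' (F ∪ C)) Ps₁ hZ₁ hF₁
        (Set.preimage_mono (Set.union_subset hFZ hCZ)) hb₁ (fun g => hpre g (hZst g)) hF₁Ps hPs₁
    obtain ⟨Q, hQ, hQZ⟩ := IsBlowup.exists_isBlowup_comp_supported φ I ψ J Z hφ hIZ hψ hJ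
    have hcomp : ((ψ ≫ φ) ⁻¹' Z : Set S₂) = ψ ⁻¹' (φ ⁻¹' Z) := by ext; simp
    refine ⟨S₂, ψ ≫ φ, Q, ρ₂, Ps₂, hQ, hQZ, fun g => ?_, ?_, ?_, hPs₂⟩
    · rw [← Category.assoc, hρ₂ g, Category.assoc, hρ₁ g, Category.assoc]
    · rw [hcomp]
      exact hsnc
    · rw [hcomp]
      exact hZ₂Ps

/-- **Equivariant strictification of a stable normal crossings divisor** (de Jong 1996, 7.2,
first half: "Since `S^(d) → S` is defined intrinsically in terms of the pair `(S, D)`, the action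
of `G` lifts"): for a Noetherian `S` of dimension `≤ d` with an action `ρ` of `G` and a `G`-stable
normal crossings divisor `Z`, there is a blowing up `φ : S' → S` in an ideal supported in `Z`,
with a `G`-action on `S'` making `φ` equivariant, such that `φ⁻¹Z` is a strict normal crossings
divisor which is a union of `G`-stable closed regular pieces. Start `equivariantStrictification_aux`
with `F = ∅`, `Ps = ∅`, `m = d` (`NormalCrossingsBranchOrderLe_holds`: the number of branches is
at most `dim 𝒪_{S,s} ≤ dim S ≤ d`). [cite: DeJong1996, 7.2, pp. 87–88] -/
theorem equivariantStrictification (S : Scheme.{u}) [IsNoetherian S] (d : ℕ)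
    (hd : topologicalKrullDim S ≤ d) (ρ : G →* Aut S) (Z : Set S)
    (hZ : IsNormalCrossingsDivisor S Z) (hZst : ∀ g : G, (ρ g).hom.base ⁻¹' Z = Z) :
    ∃ (S' : Scheme.{u}) (φ : S' ⟶ S) (I : S.IdealSheafData) (ρ' : G →* Aut S')
      (Ps' : Set (Set S')),
      IsBlowup φ I ∧ (I.support : Set S) ⊆ Z ∧ (∀ g : G, (ρ' g).hom ≫ φ = φ ≫ (ρ g).hom) ∧
      IsStrictNormalCrossingsDivisor S' (φ ⁻¹' Z) ∧ φ ⁻¹' Z = ⋃₀ Ps' ∧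
      (∀ P ∈ Ps', (∀ g : G, (ρ' g).hom.base ⁻¹' P = P) ∧ IsClosed P ∧
        ∀ s ∈ P, ∃ y : Fin 1 → S'.presheaf.stalk s, IsRsopPart y ∧
          stalkIdeal (vanishingIdeal ⟨closure P, isClosed_closure⟩) s =
            Ideal.span {∏ i, y i}) := by
  refine equivariantStrictification_aux d S ρ Z ∅ ∅ hZ (IsStrictNormalCrossingsDivisor.empty S)
    (Set.empty_subset Z) (fun s hs => ?_) hZst (by simp) (by simp)
  have h1 : (branchOrder S Z s : WithBot ℕ∞) ≤ d :=
    ((NormalCrossingsBranchOrderLe_holds S Z hZ s hs).trans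
      (ringKrullDim_stalk_le_topologicalKrullDim S s)).trans hd
  have h2 : branchOrder S Z s ≤ d := by exact_mod_cast h1
  exact h2.trans le_add_self

/-- Stability in image form gives stability in preimage form (apply to `g⁻¹`). [folklore] -/
theorem preimage_eq_of_forall_image_eq {S : Scheme.{u}} (ρ : G →* Aut S) {E : Set S}
    (h : ∀ g : G, (ρ g).hom.base '' E = E) (g : G) : (ρ g).hom.base ⁻¹' E = E := by
  have h1 := h g⁻¹
  rw [map_inv] at h1
  change (ρ g).inv.base '' E = E at h1
  rwa [image_inv_eq_preimage_hom] at h1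

/-- **The generic point of an integral locally Noetherian scheme does not lie on a normal
crossings divisor**: the branch order there would be `≥ 1` (`one_le_branchOrder`) and at most
`dim 𝒪_{S,η} = 0` (`NormalCrossingsBranchOrderLe_holds`; the local ring at the generic point is
the function field). [folklore] -/
theorem genericPoint_not_mem_of_isNormalCrossingsDivisor {S : Scheme.{u}} [IsIntegral S]
    [IsLocallyNoetherian S] {E : Set S} (hE : IsNormalCrossingsDivisor S E) :
    genericPoint S ∉ E := by
  intro hη
  have h := NormalCrossingsBranchOrderLe_holds S E hE _ hη
  have h0 : ringKrullDim (S.presheaf.stalk (genericPoint S)) = 0 :=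
    ringKrullDim_eq_zero_of_isField (Field.toIsField S.functionField)
  rw [h0] at h
  have h1 : ((1 : ℕ∞) : WithBot ℕ∞) ≤ (branchOrder S E (genericPoint S) : WithBot ℕ∞) :=
    WithBot.coe_le_coe.mpr (one_le_branchOrder hη)
  have h2 := h1.trans h
  exact absurd (WithBot.coe_le_coe.mp h2) (by simp)

/-- **De Jong 1996, 7.2: the canonical blow-up making a `G`-stable normal crossings divisor
`G`-strict** (stub C of line `FramePerfect`, v6). For a regular integral projective `S` over a
field `k` with an action `ρ` of the finite group `G` and a `G`-stable normal crossings divisor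
`E ⊆ S`, there are an integral `S'`, a modification `b : S' → S` and an action `ρ'` of `G` on `S'`
making `b` equivariant, with `S'` projective over `k` and regular, `b⁻¹E` a strict normal
crossings divisor, and `b⁻¹E` `G`-strict: an irreducible component of `b⁻¹E` meeting its
`g`-translate equals it. Proof: `b` is the composite of the blowings up of the canonical centres
of the tree's recipe for 2.4, run equivariantly with regular pieces (`equivariantStrictification`);
its centre lies in `E`, which misses the generic point, so `b` is a modification
(`IsModification.of_isBlowup`) with integral, projective (`IsBlowup.isProjectiveOver`) and
regular (`DeJong1996.isRegular_of_isBlowup_of_support_subset`) source; `G`-strictness is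
`image_eq_of_regularPieces`. [cite: DeJong1996, 7.1–7.2, pp. 87–88] -/
theorem stub_pair_canonicalStrictification :
    ∀ (k : Type) [Field k] (S : Scheme.{0}) [IsIntegral S] (p : S ⟶ Spec (.of k)),
      Motives.IsProjectiveOver (Over.mk p) → Scheme.IsRegular S →
      ∀ (G : Type) [Group G] [Finite G] (ρ : G →* Aut S) (E : Set S), IsNormalCrossingsDivisor S E →
        (∀ g : G, (ρ g).hom.base '' E = E) →
        ∃ (S' : Scheme.{0}) (_ : IsIntegral S') (b : S' ⟶ S) (ρ' : G →* Aut S'),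
          IsModification b ∧ (∀ g : G, (ρ' g).hom ≫ b = b ≫ (ρ g).hom) ∧
          Motives.IsProjectiveOver (Over.mk (b ≫ p)) ∧ Scheme.IsRegular S' ∧
          IsStrictNormalCrossingsDivisor S' (b.base ⁻¹' E) ∧
          (∀ (g : G) (C : Set S'), Maximal (fun C : Set S' => IsIrreducible C ∧ C ⊆ b.base ⁻¹' E) C →
            (C ∩ (ρ' g).hom.base '' C).Nonempty → (ρ' g).hom.base '' C = C) := by
  intro k _ S _ p hproj hreg G _ _ ρ E hE hEst
  haveI : IsNoetherian S := DeJong1996.isNoetherian_of_isProjectiveOver p hproj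
  haveI : IsProper p := Motives.IsProjectiveOver.isProper (X := Over.mk p) hproj
  obtain ⟨d, hd⟩ := exists_topologicalKrullDim_le_of_locallyOfFiniteType p
  have hEst' : ∀ g : G, (ρ g).hom.base ⁻¹' E = E := preimage_eq_of_forall_image_eq ρ hEst
  obtain ⟨S', b, I, ρ', Ps, hb, hIE, hρ', hsnc, hEPs, hPs⟩ :=
    equivariantStrictification S d hd ρ E hE hEst'
  -- the centre is not everything: `η_S ∉ E`, so `b` is a modification
  have hη : genericPoint S ∉ E := genericPoint_not_mem_of_isNormalCrossingsDivisor hE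
  have hI : I ≠ ⊥ := by
    intro hI0
    apply hη
    apply hIE
    rw [hI0, Scheme.IdealSheafData.support_bot]
    trivial
  have hmod : IsModification b := IsModification.of_isBlowup hb hI
  haveI := hmod.isIntegral
  have hreg' : Scheme.IsRegular S' :=
    DeJong1996.isRegular_of_isBlowup_of_support_subset hb hIE hreg
      fun x hx => hsnc.isRegularLocalRing hx
  refine ⟨S', hmod.isIntegral, b, ρ', hmod, hρ', hb.isProjectiveOver p hproj, hreg', hsnc, ?_⟩
  intro g K hK hne
  refine image_eq_of_regularPieces (ρ' g) hsnc.isClosed Ps hEPs (fun P hP => ?_) hK hne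
  obtain ⟨hst, hcl, hregP⟩ := hPs P hP
  refine ⟨hst g, hcl, fun s hs => ?_⟩
  obtain ⟨y, hy, hIy⟩ := hregP s hs
  rw [hIy]
  exact isPrime_span_prod_of_isRsopPart_one hy

end Summit.ResolutionOfSingularities.ResolutionOfSingularities.Theorems

end
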